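import Mathlib.NumberTheory.Padics.HeightOneSpectrum
import Literature.NumberTheory.Automorphic.StrongApproximationSL2
import HarnessLib

/-!
# Hecke level subgroups `K₀(𝔫)`, `K₁(𝔫)` and strong approximation for `GL₂` over `ℚ`

Topic `NumberTheory/Automorphic`. Continuing `StrongApproximationSL2` (density of `SL₂(K)` in
`SL₂(𝔸_K^∞)`), this file provides the two standard ingredients of the adelisation of classical
modular forms (Gelbart (1975), §3.A, (3.1)–(3.5); Bump (1997), §3.3, Thm. 3.3.1 and §3.6):

* the **Hecke level subgroups** of `GL₂(𝔸_K^∞)` for an ideal `𝔫 ⊆ 𝓞 K` of a number field: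
  `gammaZeroFiniteLevel K 𝔫 = K₀(𝔫) = {(a b; c d) ∈ GL₂(𝒪̂_K) | c ∈ 𝔫𝒪̂_K}` (the units of the
  Eichler order `eichlerOrder K 𝔫 = {M ∈ M₂(𝒪̂_K) | M₁₀ ∈ 𝔫𝒪̂_K}`, so that the subgroup axioms are
  those of Mathlib's `Submonoid.units`) and
  `gammaOneFiniteLevel K 𝔫 = K₁(𝔫) = {g ∈ K₀(𝔫) | d ≡ 1 (mod 𝔫𝒪̂_K)}`, with
  `levelIdeal K 𝔫 = 𝔫𝒪̂_K = {x ∈ 𝔸_K^∞ | ∀ v, |x_v|_v ≤ |𝔫|_v}` (`idealRadius` of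
  `GLnAdelicStructure`); both are open (`isOpen_gammaZeroFiniteLevel`,
  `isOpen_gammaOneFiniteLevel`) and contain the diagonal ideles `diag(u, 1)`, `u ∈ 𝒪̂_Kˣ`
  (`glDiagonal_mem_gammaOneFiniteLevel`);
* **strong approximation for `GL₂` over `ℚ`** (PROVED): `𝔸_ℚ^{∞,×} = ℚ_{>0}^× · Ẑ^×`
  (`Rat.FiniteAdeleRing.exists_pos_valued_algebraMap_mul_eq_one`, class number one and `ℤˣ = ±1`)
  and hence `GL₂(𝔸_ℚ^∞) = GL₂(ℚ) · U` for every open subgroup `U` containing the `diag(u, 1)`,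
  `u ∈ Ẑˣ` (`Rat.exists_generalLinearGroup_map_mul_eq`), in particular for `U = K₀(N)`, `K₁(N)`
  (`Rat.exists_generalLinearGroup_map_mul_eq_of_gammaOneFiniteLevel`,
  `Rat.exists_generalLinearGroup_map_mul_eq_of_gammaZeroFiniteLevel`): Bump (1997),
  Thm. 3.3.1 (finite-adelic form; the archimedean factor `GL₂(ℝ)⁺` of the printed
  `GL₂(𝔸_ℚ) = GL₂(ℚ) GL₂(ℝ)⁺ K₀(N)` is recovered by adjusting signs with `diag(-1, 1) ∈ GL₂(ℚ) ∩ K₁(N)`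
  and is left to the file adelising modular forms); Gelbart (1975), (3.1)–(3.2).

## Proof of strong approximation for `GL₂/ℚ`

Given `g ∈ GL₂(𝔸_ℚ^∞)`, write `det g = r u` with `r ∈ ℚ_{>0}` and `u ∈ Ẑˣ` (for each of the
finitely many `p` with `|det g|_p = p^{-n_p} ≠ 1` put `p^{n_p}` into `r`); then
`g' = diag(r, 1)⁻¹ g diag(u, 1)⁻¹` has determinant `1`, so lies in (the image of) `SL₂(𝔸_ℚ^∞)`, and
`StrongApproximationSL2.exists_specialLinearGroup_map_mul_eq` applied to the open subgroup
`SL₂ ∩ U` writes `g' = γ₁ u₁`; hence `g = (diag(r,1) γ₁) (u₁ diag(u,1)) ∈ GL₂(ℚ) U`.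

## References

* D. Bump, *Automorphic forms and representations* (1997), §3.3, Thm. 3.3.1; §3.6 [Bump1997].
* S. Gelbart, *Automorphic forms on adele groups* (1975), §3.A, (3.1)–(3.5) [Gelbart1975].
* V. Platonov, A. Rapinchuk, *Algebraic groups and number theory* (1994), §7.4, §8.1 (class
  numbers of `GL_n`) [PlatonovRapinchuk1994].
-/

noncomputable section

open Matrix IsDedekindDomain IsDedekindDomain.HeightOneSpectrum NumberField
open scoped MatrixGroups

namespace Literature.NumberTheory.Automorphic

/-! ### The ideal `𝔫𝒪̂_K` of the integral finite adeles -/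

section LevelIdeal

variable (K : Type) [Field K] [NumberField K]

/-- The ideal `𝔫 𝒪̂_K ⊆ 𝔸_K^∞` of an ideal `𝔫 ⊆ 𝓞 K`, as an additive subgroup of the finite adeles:
`x ∈ 𝔫𝒪̂_K` iff `|x_v|_v ≤ |𝔫|_v` (`idealRadius K v 𝔫`) at every finite place `v`; for `𝔫 = (N)`,
`K = ℚ` this is `N Ẑ` (Bump (1997), §3.3; Gelbart (1975), (3.2)). Junk value `𝒪̂_K` for
`𝔫 = 0` (as `idealRadius`). [folklore] -/
def levelIdeal (𝔫 : Ideal (𝓞 K)) : AddSubgroup (FiniteAdeleRing (𝓞 K) K) where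
  carrier := {x | ∀ v, Valued.v (x v) ≤ idealRadius K v 𝔫}
  zero_mem' v := by
    change Valued.v ((0 : FiniteAdeleRing (𝓞 K) K) v) ≤ _
    rw [show ((0 : FiniteAdeleRing (𝓞 K) K) v) = 0 from rfl, Valuation.map_zero]
    exact zero_le
  add_mem' {x y} hx hy v := by
    change Valued.v ((x + y) v) ≤ _
    rw [show (x + y) v = x v + y v from rfl]
    exact Valued.v.map_add_le (hx v) (hy v)
  neg_mem' {x} hx v := by
    change Valued.v ((-x) v) ≤ _
    rw [show (-x) v = -(x v) from rfl, Valuation.map_neg]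
    exact hx v

variable {K}

/-- Membership in `𝔫𝒪̂_K` (definitional). [folklore] -/
@[simp]
theorem mem_levelIdeal_iff {𝔫 : Ideal (𝓞 K)} {x : FiniteAdeleRing (𝓞 K) K} :
    x ∈ levelIdeal K 𝔫 ↔ ∀ v, Valued.v (x v) ≤ idealRadius K v 𝔫 :=
  Iff.rfl

/-- `|𝔫|_v ≤ 1` (also proved, under the same name without the prime, in
`UnramifiedHeckeScalarsProofs`, which is not imported here; librarian merge). [folklore] -/
theorem idealRadius_le_one' (v : HeightOneSpectrum (𝓞 K)) (𝔫 : Ideal (𝓞 K)) :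
    idealRadius K v 𝔫 ≤ 1 := by
  rw [idealRadius, ← WithZero.exp_zero]
  refine WithZero.exp_le_exp.2 (neg_nonpos.2 ?_)
  by_cases h𝔫 : 𝔫 = 0
  · rw [h𝔫, Submodule.zero_eq_bot, FractionalIdeal.coeIdeal_bot, FractionalIdeal.count_zero]
  · rw [FractionalIdeal.count_coe K v h𝔫]
    exact Int.natCast_nonneg _

/-- `𝔫𝒪̂_K ⊆ 𝒪̂_K`. [folklore] -/
theorem mem_integralFiniteAdeles_of_mem_levelIdeal {𝔫 : Ideal (𝓞 K)}
    {x : FiniteAdeleRing (𝓞 K) K} (hx : x ∈ levelIdeal K 𝔫) : x ∈ integralFiniteAdeles K :=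
  fun v => (mem_adicCompletionIntegers (𝓞 K) K v).2 ((hx v).trans (idealRadius_le_one' v 𝔫))

/-- `𝔫𝒪̂_K` is an `𝒪̂_K`-module: `y x ∈ 𝔫𝒪̂_K` for `y` integral and `x ∈ 𝔫𝒪̂_K`. [folklore] -/
theorem mul_mem_levelIdeal {𝔫 : Ideal (𝓞 K)} {x y : FiniteAdeleRing (𝓞 K) K}
    (hy : y ∈ integralFiniteAdeles K) (hx : x ∈ levelIdeal K 𝔫) : y * x ∈ levelIdeal K 𝔫 := by
  intro v
  rw [FiniteAdeleRing.mul_apply', Valuation.map_mul]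
  calc Valued.v (y v) * Valued.v (x v) ≤ 1 * idealRadius K v 𝔫 :=
        mul_le_mul' ((mem_adicCompletionIntegers (𝓞 K) K v).1 (hy v)) (hx v)
    _ = idealRadius K v 𝔫 := one_mul _

/-- `x y ∈ 𝔫𝒪̂_K` for `x ∈ 𝔫𝒪̂_K` and `y` integral. [folklore] -/
theorem mul_mem_levelIdeal' {𝔫 : Ideal (𝓞 K)} {x y : FiniteAdeleRing (𝓞 K) K}
    (hx : x ∈ levelIdeal K 𝔫) (hy : y ∈ integralFiniteAdeles K) : x * y ∈ levelIdeal K 𝔫 := by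
  rw [mul_comm]
  exact mul_mem_levelIdeal hy hx

/-- Closed valuation balls `{y | |y|_v ≤ r}`, `r ≠ 0`, of `K_v` are open (Mathlib
`Valued.isOpen_closedBall`, with a radius realised as `|z|_v`, `z ∈ K`, by
`valuation_surjective`). [folklore] -/
theorem isOpen_setOf_valued_le (v : HeightOneSpectrum (𝓞 K)) {r : WithZero (Multiplicative ℤ)}
    (hr : r ≠ 0) : IsOpen {y : v.adicCompletion K | Valued.v y ≤ r} := by
  obtain ⟨z, hz⟩ := v.valuation_surjective K r
  have hz' : Valued.v (z : v.adicCompletion K) = r := by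
    rw [valuedAdicCompletion_eq_valuation', hz]
  have hne : Valued.v.restrict (z : v.adicCompletion K) ≠ 0 := by
    rw [Ne, Valuation.restrict_eq_zero_iff, hz']
    exact hr
  have h := Valued.isOpen_closedBall (v.adicCompletion K) hne
  simp only [Valuation.restrict_le_iff, hz'] at h
  exact h

/-- `𝔫𝒪̂_K` is open in `𝔸_K^∞`: it contains the open additive subgroup
`{x | x_v ∈ 𝒪_v (v ∤ 𝔫), |x_v|_v ≤ |𝔫|_v (v ∣ 𝔫)}`, a finite intersection of preimages of open
balls under the continuous evaluations (for `𝔫 ≠ 0`; for `𝔫 = 0` it is `𝒪̂_K`). [folklore] -/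
theorem isOpen_levelIdeal (𝔫 : Ideal (𝓞 K)) :
    IsOpen (levelIdeal K 𝔫 : Set (FiniteAdeleRing (𝓞 K) K)) := by
  by_cases h𝔫 : 𝔫 = 0
  · -- junk case: `idealRadius = 1` everywhere, `levelIdeal = 𝒪̂`
    have : (levelIdeal K 𝔫 : Set (FiniteAdeleRing (𝓞 K) K)) = integralFiniteAdeles K := by
      ext x
      simp only [SetLike.mem_coe, mem_levelIdeal_iff, mem_integralFiniteAdeles_iff,
        mem_adicCompletionIntegers]
      refine forall_congr' fun v => ?_
      rw [h𝔫, idealRadius, Submodule.zero_eq_bot, FractionalIdeal.coeIdeal_bot,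
        FractionalIdeal.count_zero, neg_zero, WithZero.exp_zero]
    rw [this]
    exact isOpen_integralFiniteAdeles K
  -- `levelIdeal = 𝒪̂ ∩ ⋂_{v ∣ 𝔫} {x | |x_v| ≤ |𝔫|_v}`
  have hfin := Ideal.finite_factors h𝔫
  have heq : (levelIdeal K 𝔫 : Set (FiniteAdeleRing (𝓞 K) K)) =
      (integralFiniteAdeles K : Set (FiniteAdeleRing (𝓞 K) K)) ∩
        ⋂ v ∈ {v : HeightOneSpectrum (𝓞 K) | v.asIdeal ∣ 𝔫},
          {x | Valued.v (x v) ≤ idealRadius K v 𝔫} := by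
    ext x
    simp only [SetLike.mem_coe, mem_levelIdeal_iff, Set.mem_inter_iff,
      mem_integralFiniteAdeles_iff, mem_adicCompletionIntegers, Set.mem_iInter, Set.mem_setOf_eq]
    constructor
    · intro hx
      exact ⟨fun v => (hx v).trans (idealRadius_le_one' v 𝔫), fun v _ => hx v⟩
    · rintro ⟨h1, h2⟩ v
      by_cases hv : v.asIdeal ∣ 𝔫
      · exact h2 v hv
      · rw [idealRadius_eq_one_of_not_dvd h𝔫 hv]
        exact h1 v
  rw [heq]
  refine (isOpen_integralFiniteAdeles K).inter (hfin.isOpen_biInter fun v _ => ?_)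
  have hcont : Continuous fun x : FiniteAdeleRing (𝓞 K) K => x v :=
    RestrictedProduct.continuous_eval v
  exact (isOpen_setOf_valued_le v (WithZero.exp_ne_zero : idealRadius K v 𝔫 ≠ 0)).preimage hcont

end LevelIdeal

/-! ### The Eichler order and the Hecke level subgroups `K₀(𝔫)`, `K₁(𝔫)` -/

section Levels

variable (K : Type) [Field K] [NumberField K]

/-- The **Eichler order of level `𝔫`** in `M₂(𝔸_K^∞)`: integral matrices whose lower left entry
lies in `𝔫𝒪̂_K`, `{(a b; c d) ∈ M₂(𝒪̂_K) | c ∈ 𝔫𝒪̂_K}` — a subring (the product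
`(MN)₁₀ = M₁₀ N₀₀ + M₁₁ N₁₀` stays in the ideal `𝔫𝒪̂_K`), whose unit group is `K₀(𝔫)`
(Vignéras, *Arithmétique des algèbres de quaternions*, Ch. II §2 (ordres d'Eichler); Bump (1997),
§3.3). [folklore] -/
def eichlerOrder (𝔫 : Ideal (𝓞 K)) :
    Subring (Matrix (Fin 2) (Fin 2) (FiniteAdeleRing (𝓞 K) K)) where
  carrier := {M | (∀ i j, M i j ∈ integralFiniteAdeles K) ∧ M 1 0 ∈ levelIdeal K 𝔫}
  mul_mem' {M N} hM hN := by
    refine ⟨fun i j => ?_, ?_⟩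
    · rw [Matrix.mul_apply]
      exact sum_mem fun k _ => mul_mem (hM.1 i k) (hN.1 k j)
    · rw [Matrix.mul_apply, Fin.sum_univ_two]
      exact add_mem (mul_mem_levelIdeal' hM.2 (hN.1 0 0)) (mul_mem_levelIdeal (hM.1 1 1) hN.2)
  one_mem' := ⟨fun i j => by rw [Matrix.one_apply]; split_ifs <;> simp [one_mem, zero_mem],
    by rw [Matrix.one_apply_ne (by decide)]; exact zero_mem _⟩
  add_mem' {M N} hM hN :=
    ⟨fun i j => by rw [Matrix.add_apply]; exact add_mem (hM.1 i j) (hN.1 i j),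
      by rw [Matrix.add_apply]; exact add_mem hM.2 hN.2⟩
  zero_mem' := ⟨fun i j => zero_mem _, zero_mem _⟩
  neg_mem' {M} hM :=
    ⟨fun i j => by rw [Matrix.neg_apply]; exact neg_mem (hM.1 i j),
      by rw [Matrix.neg_apply]; exact neg_mem hM.2⟩

variable {K} in
/-- Membership in the Eichler order (definitional). [folklore] -/
theorem mem_eichlerOrder_iff {𝔫 : Ideal (𝓞 K)}
    {M : Matrix (Fin 2) (Fin 2) (FiniteAdeleRing (𝓞 K) K)} :
    M ∈ eichlerOrder K 𝔫 ↔ (∀ i j, M i j ∈ integralFiniteAdeles K) ∧ M 1 0 ∈ levelIdeal K 𝔫 :=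
  Iff.rfl

/-- The **Hecke level subgroup `K₀(𝔫) ≤ GL₂(𝔸_K^∞)`**: invertible finite-adelic matrices `g`
with `g, g⁻¹` in the Eichler order of level `𝔫`, i.e. `g ∈ GL₂(𝒪̂_K)` with lower left entry in
`𝔫𝒪̂_K`; for `K = ℚ`, `𝔫 = (N)` this is `K₀(N) = ∏_p K_p^N` of Gelbart (1975), (3.2) and Bump
(1997), §3.3 (`K₀(N)`), with `GL₂(ℚ) ∩ GL₂(ℝ)⁺ K₀(N) = Γ₀(N)` (Gelbart (3.5)). Mathlib
`Submonoid.units` of the Eichler order, like `glFiniteIntegralLevel`. [cite: Gelbart1975, (3.2)] -/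
def gammaZeroFiniteLevel (𝔫 : Ideal (𝓞 K)) : Subgroup (GL (Fin 2) (FiniteAdeleRing (𝓞 K) K)) :=
  (eichlerOrder K 𝔫).toSubmonoid.units

variable {K} in
/-- Membership in `K₀(𝔫)`: `g` and `g⁻¹` lie in the Eichler order. [folklore] -/
theorem mem_gammaZeroFiniteLevel_iff {𝔫 : Ideal (𝓞 K)} {g : GL (Fin 2) (FiniteAdeleRing (𝓞 K) K)} :
    g ∈ gammaZeroFiniteLevel K 𝔫 ↔
      (g : Matrix (Fin 2) (Fin 2) (FiniteAdeleRing (𝓞 K) K)) ∈ eichlerOrder K 𝔫 ∧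
        ((g⁻¹ : GL (Fin 2) (FiniteAdeleRing (𝓞 K) K)) :
          Matrix (Fin 2) (Fin 2) (FiniteAdeleRing (𝓞 K) K)) ∈ eichlerOrder K 𝔫 :=
  Iff.rfl

variable {K} in
/-- `K₀(𝔫) ≤ GL₂(𝒪̂_K)`. [folklore] -/
theorem gammaZeroFiniteLevel_le_glFiniteIntegralLevel (𝔫 : Ideal (𝓞 K)) :
    gammaZeroFiniteLevel K 𝔫 ≤ glFiniteIntegralLevel 2 K :=
  fun _ hg => ⟨hg.1.1, hg.2.1⟩

/-- The **Hecke level subgroup `K₁(𝔫) ≤ K₀(𝔫)`**: the `g = (a b; c d) ∈ K₀(𝔫)` with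
`d ≡ 1 (mod 𝔫𝒪̂_K)`; for `K = ℚ`, `𝔫 = (N)` this is `K₁(N)` with
`GL₂(ℚ) ∩ GL₂(ℝ)⁺ K₁(N) = Γ₁(N)`, the level used to adelise `S_k(Γ₁(N))` (Gelbart (1975), §3.A;
Bump (1997), §3.6; Diamond–Im, §11.1). Closure under products: `d'' - 1 = c b' + (d - 1) d' + (d' - 1)`;
under inverses: `(g⁻¹)₁₁ - 1 = det(g)⁻¹ (a (1 - d) + b c)` with `det g ∈ 𝒪̂_Kˣ`. [cite: Gelbart1975, §3.A] -/
def gammaOneFiniteLevel (𝔫 : Ideal (𝓞 K)) : Subgroup (GL (Fin 2) (FiniteAdeleRing (𝓞 K) K)) where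
  carrier := {g | g ∈ gammaZeroFiniteLevel K 𝔫 ∧
    (g : Matrix (Fin 2) (Fin 2) (FiniteAdeleRing (𝓞 K) K)) 1 1 - 1 ∈ levelIdeal K 𝔫}
  one_mem' := ⟨one_mem _, by rw [Units.val_one, Matrix.one_apply_eq, sub_self]; exact zero_mem _⟩
  mul_mem' {g g'} hg hg' := by
    refine ⟨mul_mem hg.1 hg'.1, ?_⟩
    have hgi := (mem_eichlerOrder_iff.1 hg.1.1).1
    have hgi' := (mem_eichlerOrder_iff.1 hg'.1.1).1
    have key : ((g * g' : GL (Fin 2) (FiniteAdeleRing (𝓞 K) K)) :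
        Matrix (Fin 2) (Fin 2) (FiniteAdeleRing (𝓞 K) K)) 1 1 - 1 =
        (g : Matrix (Fin 2) (Fin 2) (FiniteAdeleRing (𝓞 K) K)) 1 0 *
            (g' : Matrix (Fin 2) (Fin 2) (FiniteAdeleRing (𝓞 K) K)) 0 1 +
          ((g : Matrix (Fin 2) (Fin 2) (FiniteAdeleRing (𝓞 K) K)) 1 1 - 1) *
            (g' : Matrix (Fin 2) (Fin 2) (FiniteAdeleRing (𝓞 K) K)) 1 1 +
          ((g' : Matrix (Fin 2) (Fin 2) (FiniteAdeleRing (𝓞 K) K)) 1 1 - 1) := by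
      rw [Units.val_mul, Matrix.mul_apply, Fin.sum_univ_two]
      ring
    rw [key]
    exact add_mem (add_mem (mul_mem_levelIdeal' (mem_eichlerOrder_iff.1 hg.1.1).2 (hgi' 0 1))
      (mul_mem_levelIdeal' hg.2 (hgi' 1 1))) hg'.2
  inv_mem' {g} hg := by
    refine ⟨inv_mem hg.1, ?_⟩
    have hgi := (mem_eichlerOrder_iff.1 hg.1.1).1
    have hgi' := (mem_eichlerOrder_iff.1 hg.1.2).1
    -- `det g` is a unit of `𝒪̂`: `det g`, `det g⁻¹` integral with product `1`
    set D : FiniteAdeleRing (𝓞 K) K := (g : Matrix (Fin 2) (Fin 2) (FiniteAdeleRing (𝓞 K) K)).det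
    set D' : FiniteAdeleRing (𝓞 K) K :=
      ((g⁻¹ : GL (Fin 2) (FiniteAdeleRing (𝓞 K) K)) : Matrix (Fin 2) (Fin 2) (FiniteAdeleRing (𝓞 K) K)).det
    have hDD' : D * D' = 1 := by
      rw [← Matrix.det_mul, ← Units.val_mul, mul_inv_cancel, Units.val_one, Matrix.det_one]
    have hD'int : D' ∈ integralFiniteAdeles K := by
      simp only [D', Matrix.det_fin_two]
      exact sub_mem (mul_mem (hgi' 0 0) (hgi' 1 1)) (mul_mem (hgi' 0 1) (hgi' 1 0))
    have hD : D = (g : Matrix (Fin 2) (Fin 2) (FiniteAdeleRing (𝓞 K) K)) 0 0 * (g : Matrix (Fin 2) (Fin 2) (FiniteAdeleRing (𝓞 K) K)) 1 1 -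
        (g : Matrix (Fin 2) (Fin 2) (FiniteAdeleRing (𝓞 K) K)) 0 1 * (g : Matrix (Fin 2) (Fin 2) (FiniteAdeleRing (𝓞 K) K)) 1 0 := Matrix.det_fin_two _
    -- `D • g⁻¹ = adj g`, so `(g⁻¹)₁₁ = D' g₀₀`
    have hadj : D • ((g⁻¹ : GL (Fin 2) (FiniteAdeleRing (𝓞 K) K)) : Matrix (Fin 2) (Fin 2) (FiniteAdeleRing (𝓞 K) K)) =
        Matrix.adjugate (g : Matrix (Fin 2) (Fin 2) (FiniteAdeleRing (𝓞 K) K)) := by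
      calc D • ((g⁻¹ : GL (Fin 2) (FiniteAdeleRing (𝓞 K) K)) : Matrix (Fin 2) (Fin 2) (FiniteAdeleRing (𝓞 K) K))
          = ((g⁻¹ : GL (Fin 2) (FiniteAdeleRing (𝓞 K) K)) : Matrix (Fin 2) (Fin 2) (FiniteAdeleRing (𝓞 K) K)) *
              ((g : Matrix (Fin 2) (Fin 2) (FiniteAdeleRing (𝓞 K) K)) * Matrix.adjugate (g : Matrix (Fin 2) (Fin 2) (FiniteAdeleRing (𝓞 K) K))) := by
            rw [Matrix.mul_adjugate, Matrix.mul_smul, Matrix.mul_one]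
        _ = Matrix.adjugate (g : Matrix (Fin 2) (Fin 2) (FiniteAdeleRing (𝓞 K) K)) := by
            rw [← Matrix.mul_assoc, Units.inv_mul, Matrix.one_mul]
    have h11 : D * ((g⁻¹ : GL (Fin 2) (FiniteAdeleRing (𝓞 K) K)) : Matrix (Fin 2) (Fin 2) (FiniteAdeleRing (𝓞 K) K)) 1 1 =
        (g : Matrix (Fin 2) (Fin 2) (FiniteAdeleRing (𝓞 K) K)) 0 0 := by
      have := congrArg (fun M : Matrix (Fin 2) (Fin 2) (FiniteAdeleRing (𝓞 K) K) => M 1 1) hadj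
      simpa [Matrix.smul_apply, Matrix.adjugate_fin_two] using this
    have key : ((g⁻¹ : GL (Fin 2) (FiniteAdeleRing (𝓞 K) K)) : Matrix (Fin 2) (Fin 2) (FiniteAdeleRing (𝓞 K) K)) 1 1 - 1 =
        D' * ((g : Matrix (Fin 2) (Fin 2) (FiniteAdeleRing (𝓞 K) K)) 0 0 * (-((g : Matrix (Fin 2) (Fin 2) (FiniteAdeleRing (𝓞 K) K)) 1 1 - 1)) +
          (g : Matrix (Fin 2) (Fin 2) (FiniteAdeleRing (𝓞 K) K)) 0 1 * (g : Matrix (Fin 2) (Fin 2) (FiniteAdeleRing (𝓞 K) K)) 1 0) := by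
      have h1 : (1 : FiniteAdeleRing (𝓞 K) K) = D' * D := by rw [mul_comm, hDD']
      calc ((g⁻¹ : GL (Fin 2) (FiniteAdeleRing (𝓞 K) K)) : Matrix (Fin 2) (Fin 2) (FiniteAdeleRing (𝓞 K) K)) 1 1 - 1
          = D' * (D * ((g⁻¹ : GL (Fin 2) (FiniteAdeleRing (𝓞 K) K)) : Matrix (Fin 2) (Fin 2) (FiniteAdeleRing (𝓞 K) K)) 1 1) - D' * D := by
            rw [← mul_assoc, ← h1, one_mul]
        _ = D' * ((g : Matrix (Fin 2) (Fin 2) (FiniteAdeleRing (𝓞 K) K)) 0 0 * (-((g : Matrix (Fin 2) (Fin 2) (FiniteAdeleRing (𝓞 K) K)) 1 1 - 1)) +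
              (g : Matrix (Fin 2) (Fin 2) (FiniteAdeleRing (𝓞 K) K)) 0 1 * (g : Matrix (Fin 2) (Fin 2) (FiniteAdeleRing (𝓞 K) K)) 1 0) := by rw [h11, hD]; ring
    rw [key]
    exact mul_mem_levelIdeal hD'int (add_mem
      (mul_mem_levelIdeal (hgi 0 0) (neg_mem hg.2))
      (mul_mem_levelIdeal (hgi 0 1) (mem_eichlerOrder_iff.1 hg.1.1).2))

variable {K}

/-- Membership in `K₁(𝔫)` (definitional). [folklore] -/
theorem mem_gammaOneFiniteLevel_iff {𝔫 : Ideal (𝓞 K)} {g : GL (Fin 2) (FiniteAdeleRing (𝓞 K) K)} :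
    g ∈ gammaOneFiniteLevel K 𝔫 ↔ g ∈ gammaZeroFiniteLevel K 𝔫 ∧
      (g : Matrix (Fin 2) (Fin 2) (FiniteAdeleRing (𝓞 K) K)) 1 1 - 1 ∈ levelIdeal K 𝔫 :=
  Iff.rfl

/-- `K₁(𝔫) ≤ K₀(𝔫)`. [folklore] -/
theorem gammaOneFiniteLevel_le_gammaZeroFiniteLevel (𝔫 : Ideal (𝓞 K)) :
    gammaOneFiniteLevel K 𝔫 ≤ gammaZeroFiniteLevel K 𝔫 :=
  fun _ hg => hg.1

/-- The Eichler order is open in `M₂(𝔸_K^∞)` (entries in the open `𝒪̂_K`, lower left entry in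
the open `𝔫𝒪̂_K`). [folklore] -/
theorem isOpen_eichlerOrder (𝔫 : Ideal (𝓞 K)) :
    IsOpen (eichlerOrder K 𝔫 : Set (Matrix (Fin 2) (Fin 2) (FiniteAdeleRing (𝓞 K) K))) := by
  have h1 : IsOpen {M : Matrix (Fin 2) (Fin 2) (FiniteAdeleRing (𝓞 K) K) |
      ∀ i j, M i j ∈ integralFiniteAdeles K} :=
    (isOpen_integralFiniteAdeles K).matrix
  have h2 : IsOpen {M : Matrix (Fin 2) (Fin 2) (FiniteAdeleRing (𝓞 K) K) |
      M 1 0 ∈ levelIdeal K 𝔫} :=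
    (isOpen_levelIdeal 𝔫).preimage (continuous_id.matrix_elem 1 0)
  exact h1.inter h2

/-- **`K₀(𝔫)` is open in `GL₂(𝔸_K^∞)`** (units of the open Eichler order, Mathlib
`Submonoid.isOpen_units`). [folklore] -/
theorem isOpen_gammaZeroFiniteLevel (𝔫 : Ideal (𝓞 K)) :
    IsOpen (gammaZeroFiniteLevel K 𝔫 : Set (GL (Fin 2) (FiniteAdeleRing (𝓞 K) K))) :=
  Submonoid.isOpen_units (isOpen_eichlerOrder 𝔫)

/-- **`K₁(𝔫)` is open in `GL₂(𝔸_K^∞)`** (`K₀(𝔫)` is open and `g ↦ g₁₁ - 1` is continuous into the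
open `𝔫𝒪̂_K`). [folklore] -/
theorem isOpen_gammaOneFiniteLevel (𝔫 : Ideal (𝓞 K)) :
    IsOpen (gammaOneFiniteLevel K 𝔫 : Set (GL (Fin 2) (FiniteAdeleRing (𝓞 K) K))) := by
  have hcont : Continuous fun g : GL (Fin 2) (FiniteAdeleRing (𝓞 K) K) =>
      (g : Matrix (Fin 2) (Fin 2) (FiniteAdeleRing (𝓞 K) K)) 1 1 - 1 :=
    ((Units.continuous_val.matrix_elem 1 1).sub continuous_const)
  exact (isOpen_gammaZeroFiniteLevel 𝔫).inter ((isOpen_levelIdeal 𝔫).preimage hcont)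

/-- The diagonal ideles `diag(u, 1)`, `u ∈ 𝒪̂_Kˣ` (`|u_v|_v = 1` for all `v`), lie in `K₁(𝔫)`
(so `det K₁(𝔫) = det K₀(𝔫) = 𝒪̂_Kˣ`; Bump (1997), Thm. 3.3.1, hypothesis on `K`). [folklore] -/
theorem glDiagonal_mem_gammaOneFiniteLevel (𝔫 : Ideal (𝓞 K)) {u : (FiniteAdeleRing (𝓞 K) K)ˣ}
    (hu : ∀ v, Valued.v ((u : FiniteAdeleRing (𝓞 K) K) v) = 1) :
    glDiagonal 2 (FiniteAdeleRing (𝓞 K) K) ![u, 1] ∈ gammaOneFiniteLevel K 𝔫 := by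
  have hu' : ∀ v, Valued.v ((↑u⁻¹ : FiniteAdeleRing (𝓞 K) K) v) = 1 := fun v => by
    have h := congrArg (fun x : FiniteAdeleRing (𝓞 K) K => Valued.v (x v)) u.mul_inv
    simp only [FiniteAdeleRing.mul_apply', Valuation.map_mul, hu v, one_mul] at h
    rw [h]
    exact Valuation.map_one _
  have hint : ∀ (w : (FiniteAdeleRing (𝓞 K) K)ˣ), (∀ v, Valued.v ((w : FiniteAdeleRing (𝓞 K) K) v) = 1) →
      ∀ i j, (Matrix.diagonal fun k => ((![w, 1] k : (FiniteAdeleRing (𝓞 K) K)ˣ) :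
        FiniteAdeleRing (𝓞 K) K)) i j ∈ integralFiniteAdeles K := by
    intro w hw i j
    rw [Matrix.diagonal_apply]
    split_ifs with h
    · subst h
      fin_cases i
      · intro v
        exact (mem_adicCompletionIntegers (𝓞 K) K v).2 (hw v).le
      · simp [one_mem]
    · exact zero_mem _
  have hmem : ∀ (w : (FiniteAdeleRing (𝓞 K) K)ˣ), (∀ v, Valued.v ((w : FiniteAdeleRing (𝓞 K) K) v) = 1) →
      (Matrix.diagonal fun k => ((![w, 1] k : (FiniteAdeleRing (𝓞 K) K)ˣ) :
        FiniteAdeleRing (𝓞 K) K)) ∈ eichlerOrder K 𝔫 := fun w hw =>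
    ⟨hint w hw, by rw [Matrix.diagonal_apply_ne _ (by decide)]; exact zero_mem _⟩
  refine ⟨mem_gammaZeroFiniteLevel_iff.2 ⟨?_, ?_⟩, ?_⟩
  · rw [coe_glDiagonal]
    exact hmem u hu
  · rw [← map_inv, coe_glDiagonal]
    have : (fun k => ((((![u, 1] : Fin 2 → (FiniteAdeleRing (𝓞 K) K)ˣ)⁻¹) k :
        (FiniteAdeleRing (𝓞 K) K)ˣ) : FiniteAdeleRing (𝓞 K) K)) =
        fun k => ((![u⁻¹, 1] k : (FiniteAdeleRing (𝓞 K) K)ˣ) : FiniteAdeleRing (𝓞 K) K) := by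
      funext k
      fin_cases k <;> simp
    rw [this]
    exact hmem u⁻¹ hu'
  · rw [coe_glDiagonal, Matrix.diagonal_apply_eq]
    simp

end Levels

/-! ### Places of `ℚ`: valuations of primes -/

section RatPlaces

open Rat.HeightOneSpectrum

variable (v : HeightOneSpectrum (𝓞 ℚ))

/-- The prime ideal of the place `v` of `ℚ` is generated by the rational prime `p_v` under it
(`p_v = natGenerator v = primesEquiv v`; as in `HeckeCharacterProofs`). [folklore] -/
theorem Rat.asIdeal_eq_span_natGenerator' :
    v.asIdeal = Ideal.span {(natGenerator v : 𝓞 ℚ)} := by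
  set e := Rat.IsIntegralClosure.intEquiv (𝓞 ℚ) with he
  calc v.asIdeal = (v.asIdeal.map e).comap e := (Ideal.comap_map_of_bijective e e.bijective).symm
    _ = (Ideal.span {(natGenerator v : ℤ)}).comap e := by rw [← span_natGenerator]
    _ = (Ideal.span {(natGenerator v : ℤ)}).map e.symm := (Ideal.map_symm e).symm
    _ = Ideal.span {(natGenerator v : 𝓞 ℚ)} := by
        rw [Ideal.map_span, Set.image_singleton, map_natCast]

/-- `|p_v|_v = exp (-1)`: the rational prime under `v` is a uniformizer at `v`
(Mathlib `intValuation_singleton`). [folklore] -/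
theorem Rat.valuation_natGenerator_self :
    v.valuation ℚ (natGenerator v : ℚ) = WithZero.exp (-1 : ℤ) := by
  have hp : (natGenerator v : 𝓞 ℚ) ≠ 0 := by
    exact_mod_cast (prime_natGenerator v).ne_zero
  rw [← map_natCast (algebraMap (𝓞 ℚ) ℚ), valuation_of_algebraMap,
    intValuation_singleton v hp (Rat.asIdeal_eq_span_natGenerator' v)]

/-- `|p_v|_w = 1` for a place `w ≠ v` of `ℚ` (distinct places have distinct primes). [folklore] -/
theorem Rat.valuation_natGenerator_of_ne {v w : HeightOneSpectrum (𝓞 ℚ)} (h : w ≠ v) :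
    w.valuation ℚ (natGenerator v : ℚ) = 1 := by
  rw [← map_natCast (algebraMap (𝓞 ℚ) ℚ), valuation_eq_one_iff_notMem]
  intro hmem
  apply h
  have hle : v.asIdeal ≤ w.asIdeal := by
    rw [Rat.asIdeal_eq_span_natGenerator' v, Ideal.span_le, Set.singleton_subset_iff]
    exact hmem
  exact HeightOneSpectrum.ext (((v.isMaximal).eq_of_le w.isPrime.ne_top hle).symm)

end RatPlaces

/-! ### `𝔸_ℚ^{∞,×} = ℚ_{>0}^× · Ẑ^×` (class number one) -/

section RatIdeles

open Rat.HeightOneSpectrum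

/-- **The finite ideles of `ℚ` are `ℚ_{>0}^× · Ẑ^×`** (class number one of `ℤ` and `ℤˣ = {±1}`;
Gelbart (1975), (3.3): `𝔸^× = ℚ^× ℝ₊^× ∏_p ℤ_pˣ`; Bump (1997), Prop. 3.1.2 ff.): for every finite
idele `u` there is a positive rational `r` — namely `r = ∏_p p^{n_p}` over the finitely many `p`
with `|u_p|_p = exp(n_p) ≠ 1` (i.e. `|u_p|_p = p^{-n_p}` in real terms) — such that `r u ∈ Ẑ^×`,
i.e. `|r u_p|_p = 1` for every `p`. [cite: Gelbart1975, (3.3)] -/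
theorem Rat.FiniteAdeleRing.exists_pos_valued_algebraMap_mul_eq_one
    (u : (FiniteAdeleRing (𝓞 ℚ) ℚ)ˣ) :
    ∃ r : ℚ, 0 < r ∧ ∀ v : HeightOneSpectrum (𝓞 ℚ),
      Valued.v ((algebraMap ℚ (FiniteAdeleRing (𝓞 ℚ) ℚ) r * u) v) = 1 := by
  classical
  obtain ⟨hne, hev⟩ := FiniteAdeleRing.isUnit_iff.1 u.isUnit
  have hS : {v : HeightOneSpectrum (𝓞 ℚ) |
      ¬ Valued.v ((u : FiniteAdeleRing (𝓞 ℚ) ℚ) v) = 1}.Finite :=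
    Filter.eventually_cofinite.1 hev
  set S : Finset (HeightOneSpectrum (𝓞 ℚ)) := hS.toFinset with hSdef
  -- exponents `m_v` with `|u_v|_v = exp (m_v)`
  set m : HeightOneSpectrum (𝓞 ℚ) → ℤ := fun v =>
    WithZero.log (Valued.v ((u : FiniteAdeleRing (𝓞 ℚ) ℚ) v)) with hm
  have hm' : ∀ v, Valued.v ((u : FiniteAdeleRing (𝓞 ℚ) ℚ) v) = WithZero.exp (m v) := fun v => by
    rw [hm, WithZero.exp_log]
    exact (Valuation.ne_zero_iff _).2 (hne v)
  set r : ℚ := ∏ v ∈ S, (natGenerator v : ℚ) ^ (m v) with hr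
  have hrpos : 0 < r :=
    Finset.prod_pos fun v _ => zpow_pos (by exact_mod_cast (prime_natGenerator v).pos) _
  refine ⟨r, hrpos, fun w => ?_⟩
  -- `|r|_w = exp (-m_w)` if `w ∈ S`, `1` otherwise
  have hrw : Valued.v ((algebraMap ℚ (FiniteAdeleRing (𝓞 ℚ) ℚ) r) w) =
      ∏ v ∈ S, (if v = w then WithZero.exp (-1 : ℤ) else 1) ^ (m v) := by
    rw [FiniteAdeleRing.algebraMap_apply, valuedAdicCompletion_eq_valuation', hr, map_prod]
    refine Finset.prod_congr rfl fun v _ => ?_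
    rw [map_zpow₀]
    congr 1
    split_ifs with hvw
    · rw [hvw, Rat.valuation_natGenerator_self]
    · exact Rat.valuation_natGenerator_of_ne (Ne.symm hvw)
  rw [FiniteAdeleRing.mul_apply', Valuation.map_mul, hrw, hm' w]
  by_cases hw : w ∈ S
  · rw [Finset.prod_eq_single_of_mem w hw fun v _ hvw => by rw [if_neg hvw, _root_.one_zpow]]
    rw [if_pos rfl, ← WithZero.exp_zsmul, ← WithZero.exp_add, smul_neg, smul_eq_mul, mul_one,
      neg_add_cancel, WithZero.exp_zero]
  · rw [Finset.prod_eq_one fun v hv => by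
      rw [if_neg (fun h : v = w => hw (by rw [← h]; exact hv)), _root_.one_zpow]]
    have : Valued.v ((u : FiniteAdeleRing (𝓞 ℚ) ℚ) w) = 1 := by
      by_contra h
      exact hw (hS.mem_toFinset.2 h)
    rw [← hm' w, this, one_mul]

end RatIdeles

/-! ### Strong approximation for `GL₂` over `ℚ` -/

section RatGL2

open Matrix.SpecialLinearGroup Matrix.GeneralLinearGroup

/-- `GeneralLinearGroup.map` of a diagonal matrix of units is the diagonal matrix of the images.
[folklore] -/
theorem map_glDiagonal {n : ℕ} {R S : Type*} [CommRing R] [CommRing S] (f : R →+* S)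
    (d : Fin n → Rˣ) :
    Matrix.GeneralLinearGroup.map f (glDiagonal n R d) = glDiagonal n S fun i => Units.map f (d i) := by
  refine Units.ext ?_
  change f.mapMatrix (glDiagonal n R d : Matrix (Fin n) (Fin n) R) = _
  rw [coe_glDiagonal, coe_glDiagonal, RingHom.mapMatrix_apply, Matrix.diagonal_map (map_zero f)]
  rfl

/-- The determinant of a diagonal matrix of units is their product (also in `AutomorphicTwistSatake`
as `det_glDiagonal`, not imported here; librarian merge). [folklore] -/
theorem det_glDiagonal_eq_prod {n : ℕ} {R : Type*} [CommRing R] (d : Fin n → Rˣ) :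
    Matrix.GeneralLinearGroup.det (glDiagonal n R d) = ∏ i, d i := by
  refine Units.ext ?_
  rw [Matrix.GeneralLinearGroup.val_det_apply, coe_glDiagonal, Matrix.det_diagonal,
    Units.coe_prod]

/-- `toGL` commutes with base change: `(γ.map f : GL) = (γ : GL).map f` for `γ ∈ SL₂`. [folklore] -/
theorem toGL_map {n : Type*} [DecidableEq n] [Fintype n] {R S : Type*} [CommRing R] [CommRing S]
    (f : R →+* S) (γ : Matrix.SpecialLinearGroup n R) :
    toGL (Matrix.SpecialLinearGroup.map f γ) = Matrix.GeneralLinearGroup.map f (toGL γ) :=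
  Units.ext rfl

/-- **Strong approximation for `GL₂` over `ℚ`, finite-adelic form** (Bump (1997), Thm. 3.3.1;
Gelbart (1975), (3.1)): if `U ≤ GL₂(𝔸_ℚ^∞)` is an open subgroup containing the diagonal ideles
`diag(u, 1)`, `u ∈ Ẑˣ` (so that `det U ⊇ Ẑˣ`), then `GL₂(𝔸_ℚ^∞) = GL₂(ℚ) · U`: every `g` is
`γ k` with `γ ∈ GL₂(ℚ)` (diagonally embedded) and `k ∈ U`. Proof: `det g = r⁻¹ w` with `r ∈ ℚ_{>0}`,
`w ∈ Ẑˣ` (`Rat.FiniteAdeleRing.exists_pos_valued_algebraMap_mul_eq_one`); `diag(r⁻¹,1)⁻¹ g diag(w,1)⁻¹`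
has determinant `1` and strong approximation for `SL₂`
(`exists_specialLinearGroup_map_mul_eq`) applies to the open subgroup `SL₂(𝔸_ℚ^∞) ∩ U`.
[cite: Bump1997, Thm. 3.3.1] [cite: Gelbart1975, (3.1)] -/
theorem Rat.exists_generalLinearGroup_map_mul_eq
    (U : Subgroup (GL (Fin 2) (FiniteAdeleRing (𝓞 ℚ) ℚ)))
    (hU : IsOpen (U : Set (GL (Fin 2) (FiniteAdeleRing (𝓞 ℚ) ℚ))))
    (hdiag : ∀ u : (FiniteAdeleRing (𝓞 ℚ) ℚ)ˣ,
      (∀ v, Valued.v ((u : FiniteAdeleRing (𝓞 ℚ) ℚ) v) = 1) →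
        glDiagonal 2 (FiniteAdeleRing (𝓞 ℚ) ℚ) ![u, 1] ∈ U)
    (g : GL (Fin 2) (FiniteAdeleRing (𝓞 ℚ) ℚ)) :
    ∃ (γ : GL (Fin 2) ℚ) (k : GL (Fin 2) (FiniteAdeleRing (𝓞 ℚ) ℚ)), k ∈ U ∧
      Matrix.GeneralLinearGroup.map (algebraMap ℚ (FiniteAdeleRing (𝓞 ℚ) ℚ)) γ * k = g := by
  set φ : ℚ →+* FiniteAdeleRing (𝓞 ℚ) ℚ := algebraMap ℚ (FiniteAdeleRing (𝓞 ℚ) ℚ) with hφ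
  obtain ⟨r, hr, hru⟩ :=
    Rat.FiniteAdeleRing.exists_pos_valued_algebraMap_mul_eq_one (Matrix.GeneralLinearGroup.det g)
  set rU : ℚˣ := Units.mk0 r hr.ne' with hrU
  -- `w = r det g ∈ Ẑˣ`
  set w : (FiniteAdeleRing (𝓞 ℚ) ℚ)ˣ :=
    Units.map (φ : ℚ →* FiniteAdeleRing (𝓞 ℚ) ℚ) rU * Matrix.GeneralLinearGroup.det g with hw
  have hw1 : ∀ v, Valued.v ((w : FiniteAdeleRing (𝓞 ℚ) ℚ) v) = 1 := fun v => by
    rw [hw, Units.val_mul, Units.coe_map]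
    exact hru v
  set k₀ : GL (Fin 2) (FiniteAdeleRing (𝓞 ℚ) ℚ) := glDiagonal 2 (FiniteAdeleRing (𝓞 ℚ) ℚ) ![w, 1]
    with hk₀
  have hk₀U : k₀ ∈ U := hdiag w hw1
  set γ₀ : GL (Fin 2) ℚ := glDiagonal 2 ℚ ![rU⁻¹, 1] with hγ₀
  set g' : GL (Fin 2) (FiniteAdeleRing (𝓞 ℚ) ℚ) :=
    (Matrix.GeneralLinearGroup.map φ γ₀)⁻¹ * g * k₀⁻¹ with hg'
  -- `det g' = 1`
  have hdet₀ : Matrix.GeneralLinearGroup.det (Matrix.GeneralLinearGroup.map φ γ₀) =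
      (Units.map (φ : ℚ →* FiniteAdeleRing (𝓞 ℚ) ℚ) rU)⁻¹ := by
    rw [hγ₀, map_glDiagonal, det_glDiagonal_eq_prod, Fin.prod_univ_two]
    simp
  have hdetk : Matrix.GeneralLinearGroup.det k₀ = w := by
    rw [hk₀, det_glDiagonal_eq_prod, Fin.prod_univ_two]
    simp
  have hdet : Matrix.GeneralLinearGroup.det g' = 1 := by
    rw [hg', map_mul, map_mul, map_inv, map_inv, hdet₀, hdetk, inv_inv, hw]
    rw [_root_.mul_inv_rev, ← mul_assoc, mul_assoc (Units.map _ rU), mul_inv_cancel, mul_one,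
      mul_inv_cancel]
  -- `g'` comes from `SL₂`
  obtain ⟨s, hs⟩ : g' ∈ Set.range (toGL : SL(2, FiniteAdeleRing (𝓞 ℚ) ℚ) →
      GL (Fin 2) (FiniteAdeleRing (𝓞 ℚ) ℚ)) := by
    rw [range_toGL]
    exact hdet
  -- strong approximation for `SL₂` with the open subgroup `SL₂ ∩ U`
  have hU' : IsOpen ((U.comap (toGL : SL(2, FiniteAdeleRing (𝓞 ℚ) ℚ) →*
      GL (Fin 2) (FiniteAdeleRing (𝓞 ℚ) ℚ))) : Set SL(2, FiniteAdeleRing (𝓞 ℚ) ℚ)) :=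
    hU.preimage continuous_toGL
  obtain ⟨γ₁, u₁, hu₁, hsu⟩ := exists_specialLinearGroup_map_mul_eq (𝓞 ℚ) ℚ _ hU' s
  refine ⟨γ₀ * toGL γ₁, toGL u₁ * k₀, U.mul_mem hu₁ hk₀U, ?_⟩
  have hg : g = Matrix.GeneralLinearGroup.map φ γ₀ * g' * k₀ := by
    rw [hg']
    group
  rw [hg, ← hs, ← hsu, map_mul, map_mul, toGL_map]
  simp only [mul_assoc]
  rfl

/-- **`GL₂(𝔸_ℚ^∞) = GL₂(ℚ) K₁(N)`** (hence also `= GL₂(ℚ) K₀(N)`), the finite-adelic form of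
Bump (1997), Thm. 3.3.1 / Gelbart (1975), (3.1)–(3.2) used to adelise `S_k(Γ₁(N))`: `K₁(N)` is
open (`isOpen_gammaOneFiniteLevel`) and contains the `diag(u, 1)`, `u ∈ Ẑˣ`
(`glDiagonal_mem_gammaOneFiniteLevel`). [cite: Bump1997, Thm. 3.3.1] [cite: Gelbart1975, (3.1)] -/
theorem Rat.exists_generalLinearGroup_map_mul_eq_of_gammaOneFiniteLevel (𝔫 : Ideal (𝓞 ℚ))
    (g : GL (Fin 2) (FiniteAdeleRing (𝓞 ℚ) ℚ)) :
    ∃ (γ : GL (Fin 2) ℚ) (k : GL (Fin 2) (FiniteAdeleRing (𝓞 ℚ) ℚ)),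
      k ∈ gammaOneFiniteLevel ℚ 𝔫 ∧
        Matrix.GeneralLinearGroup.map (algebraMap ℚ (FiniteAdeleRing (𝓞 ℚ) ℚ)) γ * k = g :=
  Rat.exists_generalLinearGroup_map_mul_eq _ (isOpen_gammaOneFiniteLevel 𝔫)
    (fun _ hu => glDiagonal_mem_gammaOneFiniteLevel 𝔫 hu) g

/-- `GL₂(𝔸_ℚ^∞) = GL₂(ℚ) K₀(N)` (from the `K₁(N)` statement and `K₁(N) ≤ K₀(N)`).
[cite: Bump1997, Thm. 3.3.1] -/
theorem Rat.exists_generalLinearGroup_map_mul_eq_of_gammaZeroFiniteLevel (𝔫 : Ideal (𝓞 ℚ))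
    (g : GL (Fin 2) (FiniteAdeleRing (𝓞 ℚ) ℚ)) :
    ∃ (γ : GL (Fin 2) ℚ) (k : GL (Fin 2) (FiniteAdeleRing (𝓞 ℚ) ℚ)),
      k ∈ gammaZeroFiniteLevel ℚ 𝔫 ∧
        Matrix.GeneralLinearGroup.map (algebraMap ℚ (FiniteAdeleRing (𝓞 ℚ) ℚ)) γ * k = g := by
  obtain ⟨γ, k, hk, h⟩ := Rat.exists_generalLinearGroup_map_mul_eq_of_gammaOneFiniteLevel 𝔫 g
  exact ⟨γ, k, gammaOneFiniteLevel_le_gammaZeroFiniteLevel 𝔫 hk, h⟩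

end RatGL2

end Literature.NumberTheory.Automorphic
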